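/-
Copyright (c) 2026. All rights reserved.
Released under Apache 2.0 license as described in the file LICENSE.
Authors: HodgeCM publication cell (pub-hodgecm2), literature typer `lit-gr91-1` (gen 3).
-/
import Literature.NumberTheory.Weil1964.LocalWeilIndexHilbertSymbol
import Literature.NumberTheory.QuadraticForms.LocalNormIndex
import Literature.NumberTheory.Automorphic.AdicCompletionLocalField
import HarnessLib

/-!
# Weil's Hilbert-symbol law (28) at the finite places of a number field — no hypotheses left

[Weil1964] A. Weil, *Sur certains groupes d'opérateurs unitaires*, Acta Math. 111 (1964), Chap. II n° 28, (28),
specialised to `F = K_v`, the completion of a number field `K` at a finite place `v` (dyadic places included):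
for every non-trivial continuous `ψ`, every Haar measure `μ`, `a ≠ 0`, `b ≠ 0`,

  `γ_ψ(b) γ_ψ(-ab) = (a, b)_v · γ_ψ(1) γ_ψ(-a)`.

The one hypothesis left in `LocalWeilIndexHilbertSymbol.weilIndex_mul_weilIndex_eq_hilbertSymbol_mul_of_index_two`
— `[K_vˣ : N(K_v(√a)ˣ)] ≤ 2` — is the tree's `QuadraticForms.index_quadraticNormSubgroup_adicCompletion_eq_two`
(O'Meara 63:13a, proved there without class field theory), and `K_v` is an `IsNonarchimedeanLocalField`
(`Automorphic.AdicCompletionLocalField`).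

## References

* [Weil1964] A. Weil, *Sur certains groupes d'opérateurs unitaires*, Acta Math. 111 (1964) 143–211, Chap. II n° 28.
* [Omeara1963] O. T. O'Meara, *Introduction to quadratic forms*, Springer 1963, §63B (63:13a).
-/

set_option autoImplicit false

noncomputable section

open MeasureTheory Set NumberField IsDedekindDomain

namespace Literature.NumberTheory.Weil1964

variable (K : Type) [Field K] [NumberField K] (v : HeightOneSpectrum (𝓞 K))

/-- **the product of two non-norms is a norm in `K_v`** (`[K_vˣ : N(K_v(√a)ˣ)] = 2`, O'Meara 63:13a, tree
`index_quadraticNormSubgroup_adicCompletion_eq_two`), in the `Set.range (normForm a)` language of the Weil files.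
[cite: Omeara1963, §63B Cor. 63:13a] -/
theorem mul_mem_range_normForm_adicCompletion {a : v.adicCompletion K} (ha0 : a ≠ 0) (ha : ¬ IsSquare a)
    (s t : v.adicCompletion K) (hs : s ∉ Set.range (normForm a)) (ht : t ∉ Set.range (normForm a)) :
    s * t ∈ Set.range (normForm a) := by
  have h0 : (0 : v.adicCompletion K) ∈ Set.range (normForm a) := ⟨0, by simp [normForm_apply]⟩
  have hs0 : s ≠ 0 := fun h => hs (h ▸ h0)
  have ht0 : t ≠ 0 := fun h => ht (h ▸ h0)
  have key : ∀ {u : v.adicCompletion K} (hu : u ≠ 0),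
      Units.mk0 u hu ∈ QuadraticForms.quadraticNormSubgroup (v.adicCompletion K) a ↔ u ∈ Set.range (normForm a) := by
    intro u hu
    rw [QuadraticForms.mem_quadraticNormSubgroup_iff, Units.val_mk0]
    constructor
    · rintro ⟨x, y, h⟩; exact ⟨(x, y), by rw [normForm_apply]; exact h⟩
    · rintro ⟨z, hz⟩; exact ⟨z.1, z.2, by rw [← normForm_apply]; exact hz⟩
  have hidx := QuadraticForms.index_quadraticNormSubgroup_adicCompletion_eq_two K v ha0 ha
  have hmul : Units.mk0 s hs0 * Units.mk0 t ht0 ∈ QuadraticForms.quadraticNormSubgroup (v.adicCompletion K) a := by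
    rw [Subgroup.mul_mem_iff_of_index_two hidx, key hs0, key ht0]
    exact ⟨fun h => absurd h hs, fun h => absurd h ht⟩
  have e : Units.mk0 (s * t) (mul_ne_zero hs0 ht0) = Units.mk0 s hs0 * Units.mk0 t ht0 := Units.ext (by simp)
  rw [← e] at hmul
  exact (key (mul_ne_zero hs0 ht0)).1 hmul

variable [MeasurableSpace (v.adicCompletion K)] [BorelSpace (v.adicCompletion K)]
  (μ : Measure (v.adicCompletion K)) [μ.IsAddHaarMeasure] {ψ : AddChar (v.adicCompletion K) Circle}

/-- **WEIL'S HILBERT-SYMBOL LAW (28) IN `K_v`, `a ∉ K_v²`**: `γ(b) γ(-ab) = (a, b)_v · γ(1) γ(-a)`.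
[cite: Weil1964, Chap. II n° 28, (28), p. 176] -/
theorem weilIndex_mul_weilIndex_eq_hilbertSymbol_mul_adicCompletion (hψ : ψ.IsContinuousNontrivial)
    {a b : v.adicCompletion K} (ha : ¬ IsSquare a) (hb : b ≠ 0) :
    weilIndex ψ μ b * weilIndex ψ μ (-(a * b)) =
      (QuadraticForms.hilbertSymbol (v.adicCompletion K) a b : ℂ) * (weilIndex ψ μ 1 * weilIndex ψ μ (-a)) := by
  haveI : CharZero (v.adicCompletion K) := charZero_of_injective_algebraMap (algebraMap K _).injective
  have ha0 : a ≠ 0 := fun h0 => ha (h0 ▸ IsSquare.zero)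
  exact weilIndex_mul_weilIndex_eq_hilbertSymbol_mul_of_index_two μ hψ ha hb two_ne_zero
    (fun s t hs ht => mul_mem_range_normForm_adicCompletion K v ha0 ha s t hs ht)

/-- **WEIL'S HILBERT-SYMBOL LAW (28) AT EVERY FINITE PLACE OF A NUMBER FIELD**, no hypotheses: for `a b ∈ K_vˣ`,
`γ_ψ(b) γ_ψ(-ab) = (a, b)_v · γ_ψ(1) γ_ψ(-a)` — equivalently, the Weil index of the norm form
`x² - ay² - bz² + abt²` of the quaternion algebra `(a, b)_{K_v}` is its Hasse invariant `(a, b)_v`.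
[cite: Weil1964, Chap. II n° 28, (28), p. 176] -/
theorem weilIndex_hilbertSymbol_law_adicCompletion (hψ : ψ.IsContinuousNontrivial) {a b : v.adicCompletion K}
    (ha0 : a ≠ 0) (hb : b ≠ 0) :
    weilIndex ψ μ b * weilIndex ψ μ (-(a * b)) =
      (QuadraticForms.hilbertSymbol (v.adicCompletion K) a b : ℂ) * (weilIndex ψ μ 1 * weilIndex ψ μ (-a)) := by
  haveI : CharZero (v.adicCompletion K) := charZero_of_injective_algebraMap (algebraMap K _).injective
  by_cases ha : IsSquare a
  · exact weilIndex_mul_weilIndex_eq_hilbertSymbol_mul_of_isSquare μ hψ ha ha0 hb two_ne_zero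
  · exact weilIndex_mul_weilIndex_eq_hilbertSymbol_mul_adicCompletion K v μ hψ ha hb

/-! ## Corollaries: `(γ(1)γ(-a))² = (a,-1)_v`, `γ(1)⁴ = (-1,-1)_v`, `γ(a)⁸ = 1` -/

omit [MeasurableSpace (v.adicCompletion K)] [BorelSpace (v.adicCompletion K)] in
/-- `(a, b)_v² = 1` in `ℂ`. [folklore] -/
private theorem hilbertSymbol_sq_eq_one (a b : v.adicCompletion K) :
    ((QuadraticForms.hilbertSymbol (v.adicCompletion K) a b : ℂ)) ^ 2 = 1 := by
  rcases QuadraticForms.hilbertSymbol_eq_one_or_eq_neg_one a b with h | h <;> simp [h]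

/-- **`(γ(1) γ(-a))² = (a, -1)_v`**: the law at `b = -1` reads `conj(γ(1)γ(-a)) = (a,-1) γ(1)γ(-a)`, and
`|γ(1)γ(-a)| = 1`. [cite: Weil1964, Chap. II n° 28, pp. 176–177] -/
theorem weilIndex_one_mul_weilIndex_neg_sq (hψ : ψ.IsContinuousNontrivial) {a : v.adicCompletion K}
    (ha0 : a ≠ 0) :
    (weilIndex ψ μ 1 * weilIndex ψ μ (-a)) ^ 2 = (QuadraticForms.hilbertSymbol (v.adicCompletion K) a (-1) : ℂ) := by
  haveI : CharZero (v.adicCompletion K) := charZero_of_injective_algebraMap (algebraMap K _).injective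
  have htwo : (2 : v.adicCompletion K) ≠ 0 := two_ne_zero
  set z : ℂ := weilIndex ψ μ 1 * weilIndex ψ μ (-a) with hz
  set h : ℂ := (QuadraticForms.hilbertSymbol (v.adicCompletion K) a (-1) : ℂ) with hh
  have hL := weilIndex_hilbertSymbol_law_adicCompletion K v μ hψ ha0 (b := -1) (neg_ne_zero.2 one_ne_zero)
  rw [show -(a * -1) = a by ring] at hL
  -- `γ(-1) γ(a) = conj z`
  have hconj : weilIndex ψ μ (-1) * weilIndex ψ μ a = (starRingEnd ℂ) z := by
    rw [hz, map_mul, weilIndex_neg μ hψ one_ne_zero htwo, ← weilIndex_neg μ hψ (neg_ne_zero.2 ha0) htwo, neg_neg]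
  have hnorm : ‖z‖ = 1 := by
    rw [hz, norm_mul, norm_weilIndex μ hψ one_ne_zero htwo, norm_weilIndex μ hψ (neg_ne_zero.2 ha0) htwo, mul_one]
  have hzz : z * (starRingEnd ℂ) z = 1 := by
    rw [Complex.mul_conj, Complex.normSq_eq_norm_sq, hnorm]; norm_num
  have h2 : h ^ 2 = 1 := hilbertSymbol_sq_eq_one K v a (-1)
  -- `conj z = h z` and `z conj z = 1` give `h z² = 1`, so `z² = h`
  rw [hconj] at hL
  have hz2 : h * z ^ 2 = 1 := by rw [← hzz, hL]; ring
  calc z ^ 2 = h * (h * z ^ 2) := by rw [← mul_assoc, ← pow_two, h2, one_mul]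
    _ = h := by rw [hz2, mul_one]

/-- **`γ(1)⁴ = (-1, -1)_v`**. [cite: Weil1964, Chap. II n° 28, p. 177] -/
theorem weilIndex_one_pow_four (hψ : ψ.IsContinuousNontrivial) :
    weilIndex ψ μ (1 : v.adicCompletion K) ^ 4 =
      (QuadraticForms.hilbertSymbol (v.adicCompletion K) (-1) (-1) : ℂ) := by
  have h := weilIndex_one_mul_weilIndex_neg_sq K v μ hψ (a := -1) (neg_ne_zero.2 one_ne_zero)
  rw [neg_neg, ← pow_two, ← pow_mul] at h
  exact h

/-- **`γ(a)⁸ = 1`**: the Weil index of a non-degenerate quadratic form over `K_v` is an eighth root of unity.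
[cite: Weil1964, Chap. II n° 28, p. 177] -/
theorem weilIndex_pow_eight (hψ : ψ.IsContinuousNontrivial) {a : v.adicCompletion K} (ha0 : a ≠ 0) :
    weilIndex ψ μ a ^ 8 = 1 := by
  have h1 := weilIndex_one_mul_weilIndex_neg_sq K v μ hψ (a := -a) (neg_ne_zero.2 ha0)
  rw [neg_neg] at h1
  have h4 : (weilIndex ψ μ 1 * weilIndex ψ μ a) ^ 4 = 1 := by
    rw [show (4 : ℕ) = 2 * 2 by norm_num, pow_mul, h1, hilbertSymbol_sq_eq_one]
  have h8one : weilIndex ψ μ (1 : v.adicCompletion K) ^ 8 = 1 := by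
    rw [show (8 : ℕ) = 4 * 2 by norm_num, pow_mul, weilIndex_one_pow_four K v μ hψ, hilbertSymbol_sq_eq_one]
  have h8 : (weilIndex ψ μ 1 * weilIndex ψ μ a) ^ 8 = 1 := by
    rw [show (8 : ℕ) = 4 * 2 by norm_num, pow_mul, h4, one_pow]
  rwa [mul_pow, h8one, one_mul] at h8

end Literature.NumberTheory.Weil1964
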